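import HarnessLib
import Literature.NumberTheory.LFunctions.WeilExplicitProofs
import Literature.NumberTheory.LFunctions.WeilExplicitFormulaProofs
import Literature.NumberTheory.LFunctions.WeilZeroSum
import Literature.NumberTheory.LFunctions.ZetaZeroTailSums

/-!
# Route SignCone — conditional rungs, III: the low-frequency lemma (numerical RH + explicit formula)

Support for the conditional rung theorem (items stmt-RiemannHypothesis-16301/16302). For a Weil test `u`
and `U = u ⋆ ũ`, the Guinand–Weil explicit formula (`explicit_formula_holds`) writes `W(U) = W_ar(U) − P_Λ(U)` as
the symmetric limit of the zero sums `Σ_{|Im ρ| ≤ T} m(ρ) Û(ρ)`. If every zero with `|Im ρ| ≤ H` lies on the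
critical line (`RiemannHypothesisInStripUpTo H`, tree def; e.g. Platt–Trudgian for `H = 3·10¹²`), the terms
below height `H` are `m(ρ)|û(ρ)|² ≥ 0` (`weilMellin_weilQuadratic_of_re_eq`), and the terms above height `H`
are controlled by ANY decay bound `‖Û(ρ)‖ ≤ K/|Im ρ|^k` (`k ≥ 2`) through the unconditional tail
`Σ_{|Im ρ| > H} m(ρ)/(Im ρ)² = tailInvImSq H` (`ZetaZeroTailSums`, `≤ 0.34 log H / H` for `H ≥ 2516`):

* `re_weilZeroSidePartial_ge_of_rhUpTo` — `−(K/H^{k−2})·tailInvImSq H ≤ Re Σ_{|Im ρ| ≤ T} m(ρ) Û(ρ)` for all `T`;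
* `re_weilFunctional_ge_of_rhUpTo` — the same lower bound for `Re W(U)` (limit `T → ∞`).

In the conditional rung theorem `u = g ⋆ φ` is a mollified test, whose transform decays like `|Im ρ|^{-4(m+1)}`
in the strip (`SignConeCondRungMollifier`), so the right-hand side is the unit slack up to a negligible `τ‖g‖²`.
-/

noncomputable section

-- `Summit.RiemannHypothesis.RiemannHypothesis.…` repeats a namespace component by design (D-0017 layout).
set_option linter.dupNamespace false

open scoped BigOperators ComplexConjugate Real Topology
open Complex MeasureTheory Set Filter

namespace Summit.RiemannHypothesis.RiemannHypothesis.Theorems.SignCone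

open Literature.NumberTheory.LFunctions
open Literature.NumberTheory.LFunctions.NicolasJExplicit (Zeros)
open Literature.NumberTheory.LFunctions.SchoenfeldBound (zerosUpTo mem_zerosUpTo)
open Literature.NumberTheory.LFunctions.ZetaZeroTails (tailInvImSq summable_tailInvImSq tailInvImSq_nonneg)

variable {u : ℝ → ℂ} (hu : IsWeilTest u) {H K : ℝ} {k : ℕ}

/-- A term of the zero side above height `H`: `Re (m(ρ) Û(ρ)) ≥ −(K/H^{k−2}) · m(ρ)/(Im ρ)²` when
`‖Û(ρ)‖ ≤ K/|Im ρ|^k`, `k ≥ 2`, `H < |Im ρ|`, `m(ρ) ≥ 0`. [folklore] -/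
theorem re_term_ge_of_decay (hH : 0 < H) (hK0 : 0 ≤ K) (hk : 2 ≤ k) {ρ : ℂ} {m : ℝ} (hm : 0 ≤ m)
    (hρ : H < |ρ.im|) {z : ℂ} (hz : ‖z‖ ≤ K / |ρ.im| ^ k) :
    -(K / H ^ (k - 2) * (m / ρ.im ^ 2)) ≤ ((m : ℂ) * z).re := by
  have hγ : 0 < |ρ.im| := hH.trans hρ
  have h1 : -(m * ‖z‖) ≤ ((m : ℂ) * z).re := by
    rw [Complex.re_ofReal_mul]
    have := neg_le_of_abs_le (Complex.abs_re_le_norm z)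
    nlinarith
  have h2 : K / |ρ.im| ^ k ≤ K / H ^ (k - 2) / ρ.im ^ 2 := by
    have e : |ρ.im| ^ k = |ρ.im| ^ (k - 2) * ρ.im ^ 2 := by
      rw [← sq_abs, ← pow_add, Nat.sub_add_cancel hk]
    rw [e, div_div]
    have hsq : 0 < ρ.im ^ 2 := by rw [← sq_abs]; exact pow_pos hγ 2
    exact div_le_div_of_nonneg_left hK0 (mul_pos (pow_pos hH _) hsq)
      (mul_le_mul_of_nonneg_right (pow_le_pow_left₀ hH.le hρ.le _) (sq_nonneg _))
  have h3 : m * ‖z‖ ≤ K / H ^ (k - 2) * (m / ρ.im ^ 2) := by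
    calc m * ‖z‖ ≤ m * (K / H ^ (k - 2) / ρ.im ^ 2) := mul_le_mul_of_nonneg_left (hz.trans h2) hm
      _ = K / H ^ (k - 2) * (m / ρ.im ^ 2) := by ring
  linarith

include hu in
/-- Core estimate over an arbitrary finite set of non-trivial zeros: below height `H` the terms are
`m(ρ)|û(ρ)|² ≥ 0` (numerical RH), above height `H` they are `≥ −(K/H^{k−2}) m(ρ)/(Im ρ)²`, and the latter
sum to at most the tail `tailInvImSq H`. [folklore] -/
theorem re_sum_zeros_ge_of_rhUpTo (hH : 1 ≤ H) (hRH : RiemannHypothesisInStripUpTo H)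
    (hK0 : 0 ≤ K) (hk : 2 ≤ k)
    (hK : ∀ ρ : ℂ, riemannZeta ρ = 0 → 0 < ρ.re → ρ.re < 1 → H < |ρ.im| →
      ‖weilMellin (weilConv u (weilReflect u)) ρ‖ ≤ K / |ρ.im| ^ k)
    (S : Finset Zeros) :
    -(K / H ^ (k - 2) * tailInvImSq H) ≤
      ∑ ρ ∈ S, ((riemannZetaZeroOrder (ρ : ℂ) : ℂ) * weilMellin (weilConv u (weilReflect u)) (ρ : ℂ)).re := by
  classical
  rw [← Finset.sum_filter_add_sum_filter_not S (fun ρ : Zeros => |(ρ : ℂ).im| ≤ H)]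
  -- below height H: on the line, non-negative
  have h1 : 0 ≤ ∑ ρ ∈ S.filter (fun ρ : Zeros => |(ρ : ℂ).im| ≤ H),
      ((riemannZetaZeroOrder (ρ : ℂ) : ℂ) * weilMellin (weilConv u (weilReflect u)) (ρ : ℂ)).re := by
    refine Finset.sum_nonneg fun ρ hρ => ?_
    rw [Finset.mem_filter] at hρ
    have hmem : (ρ : ℂ) ∈ ZetaZeros.riemannZetaNontrivialZeros := ρ.2
    have hre : (ρ : ℂ).re = 1 / 2 :=
      hRH ρ (ZetaZeros.riemannZetaNontrivialZeros.zeta_eq_zero hmem)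
        (ZetaZeros.riemannZetaNontrivialZeros.re_pos hmem) (ZetaZeros.riemannZetaNontrivialZeros.re_lt_one hmem) hρ.2
    rw [weilMellin_weilQuadratic_of_re_eq hu hre, ← Complex.ofReal_intCast, ← Complex.ofReal_mul,
      Complex.ofReal_re]
    have hm0 : (0 : ℝ) ≤ riemannZetaZeroOrder (ρ : ℂ) := by
      exact_mod_cast riemannZetaZeroOrder_nonneg (ZetaZeros.riemannZetaNontrivialZeros.ne_one hmem)
    exact mul_nonneg hm0 (Complex.normSq_nonneg _)
  -- above height H: the decay bound against the tail sum
  set f : Zeros → ℝ := fun ρ => if ρ ∈ zerosUpTo H then (0 : ℝ) else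
    (riemannZetaZeroOrder (ρ : ℂ) : ℝ) / (ρ : ℂ).im ^ 2 with hf
  have hfnn : ∀ ρ, 0 ≤ f ρ := fun ρ => by
    simp only [hf]
    split_ifs
    · exact le_rfl
    · exact div_nonneg (NicolasJExplicit.zeroOrder_nonneg' ρ) (sq_nonneg _)
  have h2 : -(K / H ^ (k - 2) * tailInvImSq H) ≤ ∑ ρ ∈ S.filter (fun ρ : Zeros => ¬ |(ρ : ℂ).im| ≤ H),
      ((riemannZetaZeroOrder (ρ : ℂ) : ℂ) * weilMellin (weilConv u (weilReflect u)) (ρ : ℂ)).re := by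
    set S₂ : Finset Zeros := S.filter (fun ρ : Zeros => ¬ |(ρ : ℂ).im| ≤ H) with hS₂
    have hsum : ∑ ρ ∈ S₂, f ρ ≤ tailInvImSq H :=
      (summable_tailInvImSq hH).sum_le_tsum S₂ (fun ρ _ => hfnn ρ)
    have hterm : ∀ ρ ∈ S₂, -(K / H ^ (k - 2) * f ρ) ≤
        ((riemannZetaZeroOrder (ρ : ℂ) : ℂ) * weilMellin (weilConv u (weilReflect u)) (ρ : ℂ)).re := by
      intro ρ hρ
      rw [hS₂, Finset.mem_filter, not_le] at hρ
      have hmem : (ρ : ℂ) ∈ ZetaZeros.riemannZetaNontrivialZeros := ρ.2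
      have hnot : ρ ∉ zerosUpTo H := fun h' => (not_le.2 hρ.2) (mem_zerosUpTo.1 h')
      simp only [hf]
      rw [if_neg hnot]
      have hb := hK ρ (ZetaZeros.riemannZetaNontrivialZeros.zeta_eq_zero hmem)
        (ZetaZeros.riemannZetaNontrivialZeros.re_pos hmem) (ZetaZeros.riemannZetaNontrivialZeros.re_lt_one hmem) hρ.2
      have := re_term_ge_of_decay (by linarith) hK0 hk (NicolasJExplicit.zeroOrder_nonneg' ρ) hρ.2 hb
      rw [Complex.ofReal_intCast] at this
      exact this
    calc -(K / H ^ (k - 2) * tailInvImSq H) ≤ -(K / H ^ (k - 2) * ∑ ρ ∈ S₂, f ρ) := by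
          have : 0 ≤ K / H ^ (k - 2) := by positivity
          nlinarith
      _ = ∑ ρ ∈ S₂, -(K / H ^ (k - 2) * f ρ) := by rw [Finset.mul_sum, Finset.sum_neg_distrib]
      _ ≤ _ := Finset.sum_le_sum hterm
  linarith

include hu in
/-- **Truncated zero sides under numerical RH.** If every zero with `|Im ρ| ≤ H` is on the critical line and
`‖(u ⋆ ũ)^(ρ)‖ ≤ K/|Im ρ|^k` (`k ≥ 2`) at every zero of the open strip above height `H`, then for every `T`
`−(K/H^{k−2}) · Σ_{|Im ρ|>H} m(ρ)/(Im ρ)² ≤ Re Σ_{|Im ρ| ≤ T} m(ρ) (u ⋆ ũ)^(ρ)`. [folklore] -/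
theorem re_weilZeroSidePartial_ge_of_rhUpTo (hH : 1 ≤ H) (hRH : RiemannHypothesisInStripUpTo H)
    (hK0 : 0 ≤ K) (hk : 2 ≤ k)
    (hK : ∀ ρ : ℂ, riemannZeta ρ = 0 → 0 < ρ.re → ρ.re < 1 → H < |ρ.im| →
      ‖weilMellin (weilConv u (weilReflect u)) ρ‖ ≤ K / |ρ.im| ^ k)
    (T : ℝ) :
    -(K / H ^ (k - 2) * tailInvImSq H) ≤ (weilZeroSidePartial (weilConv u (weilReflect u)) T).re := by
  rw [weilZeroSidePartial_eq_sum, Complex.re_sum]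
  exact re_sum_zeros_ge_of_rhUpTo hu hH hRH hK0 hk hK (weilZeroFinset T)

include hu in
/-- **Low-frequency lemma.** Under `RiemannHypothesisInStripUpTo H` and a decay bound `‖(u ⋆ ũ)^(ρ)‖ ≤ K/|Im ρ|^k`
(`k ≥ 2`) at the zeros above height `H`: `Re W(u ⋆ ũ) ≥ −(K/H^{k−2}) · Σ_{|Im ρ|>H} m(ρ)/(Im ρ)²`
(explicit formula `explicit_formula_holds` + `re_weilZeroSidePartial_ge_of_rhUpTo` + `ge_of_tendsto'`). [folklore] -/
theorem re_weilFunctional_ge_of_rhUpTo (hH : 1 ≤ H) (hRH : RiemannHypothesisInStripUpTo H)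
    (hK0 : 0 ≤ K) (hk : 2 ≤ k)
    (hK : ∀ ρ : ℂ, riemannZeta ρ = 0 → 0 < ρ.re → ρ.re < 1 → H < |ρ.im| →
      ‖weilMellin (weilConv u (weilReflect u)) ρ‖ ≤ K / |ρ.im| ^ k) :
    -(K / H ^ (k - 2) * tailInvImSq H) ≤ (weilFunctional (weilConv u (weilReflect u))).re := by
  have hk' : IsWeilTest (weilConv u (weilReflect u)) := hu.weilConv hu.weilReflect
  have hlim : Tendsto (fun T => (weilZeroSidePartial (weilConv u (weilReflect u)) T).re) atTop
      (𝓝 (weilFunctional (weilConv u (weilReflect u))).re) :=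
    (Complex.continuous_re.tendsto _).comp (explicit_formula_holds hk')
  exact ge_of_tendsto' hlim fun T => re_weilZeroSidePartial_ge_of_rhUpTo hu hH hRH hK0 hk hK T

end Summit.RiemannHypothesis.RiemannHypothesis.Theorems.SignCone

end
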